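import Mathlib
import HarnessLib
import Summits.ABC.ABC.Theses.CongruentialReceptacle
import Literature.NumberTheory.EllipticCurves.Szpiro

/-! Strategist s1 sketch (NOT a line; route-level ask R3 of STRATEGY-CENSUS.md §6, typed to show it elaborates):
`BoundedJSzpiro` = Szpiro 6+ε for all elliptic curves over ℚ with bounded j-invariant (compactly bounded on X(1),
degree 1) — the natural Target of an archimedean-blind receptacle — and the corresponding partner `BJToABC`. -/

set_option linter.dupNamespace false

namespace Summit.ABC.ABC.Cruxes.CompactBalanceTransfer.StrategistS1

open Literature.NumberTheory.EllipticCurves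

/-- Bounded-j Szpiro: for every bound `J` and every `ε > 0` there is `C` with `|Δ_min(E)| ≤ C·N(E)^(6+ε)` for every
elliptic curve `E/ℚ` with `|j(E)| ≤ J`. Implied by `SzpiroConjecture`; implies balanced abc `H` (Frey curves with
bounded `j`), and — via the bounded-j families `E′` (`j = 1728a/c`) and `E″` (`j = 27λ(9λ−8)³/(λ−1)`, `λ = a/c`) —
polynomial abc of exponent 3 and exponent 3/2 on bounded `rad(a)` (census T10). -/
def BoundedJSzpiro : Prop :=
  ∀ J : ℝ, ∀ ε : ℝ, 0 < ε → ∃ C : ℝ, ∀ (W : WeierstrassCurve ℚ) [W.IsElliptic],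
    |((WeierstrassCurve.j W : ℚ) : ℝ)| ≤ J →
      (W.minimalDiscriminantNorm ℤ : ℝ) ≤ C * (W.conductorNorm ℤ : ℝ) ^ (6 + ε)

/-- The archimedean partner a bounded-j Target would need (strictly weaker than `CompactBalanceTransfer` once
`BoundedJSzpiro → H` is recorded). -/
def BJToABC : Prop := BoundedJSzpiro → _root_.ABC

/-- Szpiro for all curves gives bounded-j Szpiro (drop the bound). [folklore] -/
theorem boundedJSzpiro_of_szpiro (h : SzpiroConjecture) : BoundedJSzpiro := by
  intro J ε hε
  obtain ⟨C, hC⟩ := h ε hε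
  exact ⟨C, fun W _ _ => hC W⟩

/-- `ABC` closes the partner trivially (irrefutable short of `¬ABC`). [folklore] -/
theorem bjToABC_of_abc (h : _root_.ABC) : BJToABC := fun _ => h

end Summit.ABC.ABC.Cruxes.CompactBalanceTransfer.StrategistS1
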